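import Mathlib.RingTheory.Polynomial.Resultant.Basic
import Mathlib.RingTheory.Polynomial.GaussLemma
import Mathlib.RingTheory.Polynomial.UniqueFactorization
import Mathlib.RingTheory.Polynomial.IntegralNormalization
import Mathlib.Analysis.SpecialFunctions.Log.Deriv
import Mathlib.Analysis.PSeries
import Mathlib.Analysis.Normed.Group.InfiniteSum
import Mathlib.Algebra.Field.ZMod
import Mathlib.Algebra.BigOperators.Field
import Mathlib.Data.Nat.Prime.Int
import Literature.NumberTheory.Sieve.BatemanHorn
import Literature.NumberTheory.Sieve.AletheiaZomleferFukshanskyGarcia2020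
import Literature.NumberTheory.LFunctions.DegreeOnePrimes
import HarnessLib

/-!
# Convergence of the Bateman–Horn product: the elementary reduction (Bateman–Horn 1962)

Topic `Literature/NumberTheory/Sieve`, companion ("Proofs") file of `BatemanHorn.lean`, kept
separate so that the definitions file keeps its light imports.  It works towards the named fact
`Literature.NumberTheory.Sieve.exists_hasBatemanHornConst` (for a Bateman–Horn system `f₁, …, f_k` the ordered product
`∏_p (1 - 1/p)^{-k} (1 - ω(p)/p)` converges to a positive limit), following the half-page proof
of Bateman–Horn, Math. Comp. 16 (1962), pp. 364–365 ("The convergence of the product defining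
`C(f₁, …, f_k)` may be proved as follows."):

1. (p. 364) for `i ≠ j` there are `g, h ∈ ℤ[X]` and an integer `c ≠ 0` with `g fᵢ + h fⱼ = c`
   (we take `c = Res(fᵢ, fⱼ)`, Mathlib `Polynomial.resultant`, non-zero by Gauss's lemma),
   hence `ω(p) = ω₁(p) + ⋯ + ω_k(p)` for every prime `p ∤ ∏ cᵢⱼ` — PROVED
   (`exists_polyRootCountMod_eq_sum`); this also DISCHARGES the tree's named fact
   `AZFG2020_lemma_5_4_1` (`AZFG2020_lemma_5_4_1_holds`).
2. (p. 364, "by an elementary result on the distribution of prime ideals") the series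
   `∑_p (ωᵢ(p) − 1)/p` converges for each `i` — the only non-elementary input.  Stated as
   the named fact `BatemanHorn1962_rootCountSeries` (hypotheses as in Bateman–Horn: irreducible,
   non-constant, positive leading coefficient), PROVED equivalent-in-use to the tree's leaf
   `AZFG2020_lemma_5_3_5` (the same series for MONIC irreducible `g`,
   `Literature/NumberTheory/Sieve/AletheiaZomleferFukshanskyGarcia2020.lean`) by passing to the
   monic integral normalization `g(cx) = c^{d-1} f(x)`, which is irreducible
   (`irreducible_integralNormalization`) and has `ω_g(p) = ω_f(p)` for `p ∤ c`
   (`polyRootCountMod_integralNormalization`):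
   `BatemanHorn1962_rootCountSeries_of_AZFG2020_lemma_5_3_5`; and the leaf itself is PROVED
   (`AZFG2020_lemma_5_3_5_holds`, appendix) from
   `Literature/NumberTheory/LFunctions/DegreeOnePrimes.lean` (Dedekind–Kummer, `log ζ_K − log ζ`
   at `s = 1⁺` by the class number formula residue, and the Hardy–Littlewood Tauberian theorem —
   Landau's prime ideal theorem is not needed).
3. (p. 365) `(1 - 1/p)^{-k}(1 - ω(p)/p) = 1 − (ω(p) − k)/p + β(p)/p²` with `β` bounded, so the
   product converges — PROVED, through logarithms: `log` of the `p`-th factor is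
   `−∑ᵢ (ωᵢ(p) − 1)/p + O((k + D²)/p²)` with `D = ∑ deg fᵢ` (`ωᵢ(p) ≤ deg fᵢ` for `p ∤ lc fᵢ`),
   the `O(1/p²)` terms are absolutely summable, and `exp` of the limit is the positive constant
   (`exists_hasBatemanHornConst_of_rootCountSeries`).

Net effect: `exists_hasBatemanHornConst_holds`, `IsBatemanHornSystem.hasBatemanHornConst_holds`,
`BatemanHorn1962_rootCountSeries_holds`, `AZFG2020_lemma_5_3_5_holds`, `AZFG2020_lemma_5_4_1_holds`
and display (5.4.4) of AZFG 2020 (`AZFG2020_tendsto_sum_sub_omega_div_holds`) are all PROVED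
(axioms: `propext`, `Classical.choice`, `Quot.sound`).

## References

* P. T. Bateman, R. A. Horn, *A heuristic asymptotic formula concerning the distribution of
  prime numbers*, Math. Comp. 16 (1962), 363–367 (`BatemanHornMathComp1962`), pp. 364–365.
* S. L. Aletheia-Zomlefer, L. Fukshansky, S. R. Garcia, *The Bateman–Horn conjecture:
  heuristics, history, and applications*, Expo. Math. 38 (2020), 430–479
  (`AletheiaZomleferFukshanskyGarcia2020`), §5.3 Lemma 5.3.5, §5.4 Lemma 5.4.1, (5.4.4),
  Theorem 5.4.3.
* E. Landau, *Neuer Beweis des Primzahlsatzes und Beweis des Primidealsatzes*, Math. Ann. 56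
  (1903), 645–670 (`LandauMathAnn1903`) — the "elementary result on prime ideals" of step 2
  (replaced here by the Tauberian route of `DegreeOnePrimes.lean`).
-/

noncomputable section

open Filter Finset Polynomial
open scoped Topology

namespace Literature.NumberTheory.Sieve

variable {ι : Type*} [Fintype ι]

/-! ### The vendored non-elementary input (step 2) -/

/-- **Bateman–Horn 1962, p. 364 (convergence of `∑_p (ω_f(p) − 1) p⁻¹`).**  Let `f ∈ ℤ[X]`
be an irreducible non-constant polynomial with positive leading coefficient (the hypotheses of
the Bateman–Horn conjecture on a single polynomial) and let `ω_f(p)` denote the number of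
solutions of `f(x) ≡ 0 (mod p)`.  Then the series `∑_p (ω_f(p) − 1)/p`, over the primes in
increasing order, converges; i.e. the partial sums over `p ≤ x` have a finite limit.
Bateman–Horn: "for all but finitely many `p`, `ωᵢ(p)` is equal to the number of prime ideals of
first degree and norm `p` in the field `ℚ(θᵢ)` … by an elementary result on the distribution of
prime ideals we have `∑_{p ≤ x} ωᵢ(p) p⁻¹ = log log x + Aᵢ + o(1)`, … Thus the series
`∑ (ωᵢ(p) − 1) p⁻¹` converges."  (The "elementary result" is Landau's Mertens theorem for number
fields, a consequence of the prime ideal theorem `Literature.NumberTheory.LFunctions.NumberField.primeIdealTheorem`.)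
Here `ω_f(p) = polyRootCountMod ![f] p`.
[cite: BatemanHornMathComp1962, p. 364 ("Thus the series ∑ (ωᵢ(p) − 1) p⁻¹ converges for i = 1, …, k")] -/
def BatemanHorn1962_rootCountSeries : Prop :=
  ∀ f : ℤ[X], Irreducible f → 0 < f.natDegree → 0 < f.leadingCoeff →
    ∃ A : ℝ, Tendsto (fun x : ℕ ↦ ∑ p ∈ Nat.primesLE x,
      ((polyRootCountMod ![f] p : ℝ) - 1) / p) atTop (𝓝 A)

/-! ### Step 1: local root counts of a system split as a sum (B–H p. 364) -/

/-- `ω` of the one-member family `![g]` is the root count of `g` modulo `p`. [folklore] -/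
theorem polyRootCountMod_single (g : ℤ[X]) (p : ℕ) :
    polyRootCountMod ![g] p = #((range p).filter fun n : ℕ ↦ (p : ℤ) ∣ g.eval (n : ℤ)) := by
  simp only [polyRootCountMod, Fin.prod_univ_one, Matrix.cons_val_fin_one]

/-- Lagrange: if `p ∤ lc(g)` then `g` has at most `deg g` roots modulo the prime `p`.
[folklore] -/
theorem polyRootCountMod_single_le_natDegree {g : ℤ[X]} {p : ℕ} (hp : p.Prime)
    (hlc : ¬ (p : ℤ) ∣ g.leadingCoeff) : polyRootCountMod ![g] p ≤ g.natDegree := by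
  classical
  haveI := Fact.mk hp
  rw [polyRootCountMod_single]
  set g' : (ZMod p)[X] := g.map (Int.castRingHom (ZMod p)) with hg'
  have hg'0 : g' ≠ 0 := by
    intro h
    apply hlc
    have hc : g'.coeff g.natDegree = 0 := by rw [h, coeff_zero]
    rwa [hg', coeff_map, coeff_natDegree, eq_intCast, ZMod.intCast_zmod_eq_zero_iff_dvd] at hc
  calc #((range p).filter fun n : ℕ ↦ (p : ℤ) ∣ g.eval (n : ℤ))
      ≤ #(g'.roots.toFinset) := by
        refine Finset.card_le_card_of_injOn (fun n : ℕ ↦ (n : ZMod p)) ?_ ?_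
        · intro n hn
          rw [mem_coe, mem_filter, mem_range] at hn
          simp only [mem_coe, Multiset.mem_toFinset, mem_roots hg'0, IsRoot.def]
          rw [hg', ← Int.cast_natCast, eval_intCast_map, eq_intCast,
            ZMod.intCast_zmod_eq_zero_iff_dvd]
          exact hn.2
        · intro m hm n hn hmn
          rw [mem_coe, mem_filter, mem_range] at hm hn
          have := congrArg ZMod.val hmn
          rwa [ZMod.val_natCast_of_lt hm.1, ZMod.val_natCast_of_lt hn.1] at this
    _ ≤ Multiset.card g'.roots := Multiset.toFinset_card_le _
    _ ≤ g'.natDegree := card_roots' _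
    _ ≤ g.natDegree := natDegree_map_le

/-- Two non-associated irreducible polynomials `g, h ∈ ℤ[X]` satisfy `g a + h b = c` for some
`a, b ∈ ℤ[X]` and an integer `c ≠ 0` (for non-constant `g`, `c = Res(g, h)`, non-zero because
`g, h` are coprime in `ℚ[X]` by Gauss's lemma). Bateman–Horn 1962, p. 364, first display;
Aletheia-Zomlefer–Fukshansky–Garcia 2020, proof of Lemma 5.4.1. [folklore] -/
theorem exists_mul_add_mul_eq_C_of_not_associated {g h : ℤ[X]} (hg : Irreducible g)
    (hh : Irreducible h) (hgh : ¬Associated g h) :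
    ∃ (a b : ℤ[X]) (c : ℤ), c ≠ 0 ∧ g * a + h * b = C c := by
  rcases Nat.eq_zero_or_pos g.natDegree with hg0 | hg0
  · -- `g = C c` is a (prime) constant: `g · 1 + h · 0 = c`.
    refine ⟨1, 0, g.coeff 0, fun h0 ↦ hg.ne_zero ?_, ?_⟩
    · rw [eq_C_of_natDegree_eq_zero hg0, h0, C_0]
    · rw [mul_one, mul_zero, add_zero]
      exact eq_C_of_natDegree_eq_zero hg0
  obtain ⟨a, b, -, -, hab⟩ :=
    exists_mul_add_mul_eq_C_resultant g h le_rfl le_rfl (Or.inl hg0.ne')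
  refine ⟨a, b, _, fun hres ↦ hgh ?_, hab⟩
  set φ := Int.castRingHom ℚ
  have hprim : g.IsPrimitive := hg.isPrimitive hg0.ne'
  have hgQ : Irreducible (g.map φ) :=
    (IsPrimitive.Int.irreducible_iff_irreducible_map_cast hprim).mp hg
  have e1 : (g.map φ).natDegree = g.natDegree := natDegree_map_eq_of_injective φ.injective_int g
  have e2 : (h.map φ).natDegree = h.natDegree := natDegree_map_eq_of_injective φ.injective_int h
  have hresQ : resultant (g.map φ) (h.map φ) = 0 := by
    rw [e1, e2, resultant_map_map, hres, map_zero]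
  obtain ⟨-, hnc⟩ := resultant_eq_zero_iff.mp hresQ
  have hdvdQ : g.map φ ∣ h.map φ := by
    by_contra hnd
    exact hnc (hgQ.coprime_iff_not_dvd.mpr hnd)
  exact hg.associated_of_dvd hh
    ((IsPrimitive.Int.dvd_iff_map_cast_dvd_map_cast g h hprim).mpr hdvdQ)

/-- In a Bateman–Horn system every member is non-constant: an irreducible constant `fᵢ = c` has
a prime factor `q ∣ c`, and then `q` is a fixed prime divisor of `∏ fⱼ`. [folklore] -/
theorem IsBatemanHornSystem.natDegree_pos {f : ι → ℤ[X]} (hf : IsBatemanHornSystem f) (i : ι) :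
    0 < (f i).natDegree := by
  by_contra h0
  have h0 : (f i).natDegree = 0 := by omega
  have ha : f i = C ((f i).coeff 0) := eq_C_of_natDegree_eq_zero h0
  set a := (f i).coeff 0
  have hau : ¬IsUnit a := fun hu ↦ (hf.irreducible i).not_isUnit (ha ▸ isUnit_C.mpr hu)
  have ha1 : a.natAbs ≠ 1 := fun h1 ↦ hau (Int.isUnit_iff_natAbs_eq.mpr h1)
  obtain ⟨q, hq, hqa⟩ := Nat.exists_prime_and_dvd ha1
  have hqa' : (q : ℤ) ∣ a := Int.natCast_dvd.mpr hqa
  refine (hf.hasNoFixedPrimeDivisor q hq).ne ?_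
  unfold polyRootCountMod
  rw [filter_true_of_mem, card_range]
  intro n _
  refine hqa'.trans ?_
  have : (f i).eval (n : ℤ) = a := by rw [ha, eval_C]
  rw [← this]
  exact Finset.dvd_prod_of_mem (fun j ↦ (f j).eval (n : ℤ)) (mem_univ i)

/-- **Bateman–Horn 1962, p. 364** (= Aletheia-Zomlefer–Fukshansky–Garcia 2020, Lemma 5.4.1):
for irreducible, pairwise non-associated `f₁, …, f_k ∈ ℤ[X]`, `ω(p) = ω₁(p) + ⋯ + ω_k(p)` for
all primes `p ∤ ∏_{i ≠ j} cᵢⱼ`, in particular for all sufficiently large primes `p`.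
[folklore] -/
theorem exists_polyRootCountMod_eq_sum {f : ι → ℤ[X]} (hirr : ∀ i, Irreducible (f i))
    (hna : Pairwise fun i j ↦ ¬Associated (f i) (f j)) :
    ∃ P₀ : ℕ, ∀ p : ℕ, p.Prime → P₀ < p →
      polyRootCountMod f p = ∑ i, polyRootCountMod ![f i] p := by
  classical
  have key : ∀ i j : ι, i ≠ j → ∃ (a b : ℤ[X]) (c : ℤ), c ≠ 0 ∧ f i * a + f j * b = C c :=
    fun i j hij ↦ exists_mul_add_mul_eq_C_of_not_associated (hirr i) (hirr j) (hna hij)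
  choose! a b c hc0 hc using key
  refine ⟨∑ i, ∑ j, (c i j).natAbs, fun p hp hP ↦ ?_⟩
  have hpc : ∀ i j, i ≠ j → ¬(p : ℤ) ∣ c i j := by
    intro i j hij hdvd
    have h1 : p ∣ (c i j).natAbs := Int.natCast_dvd.mp hdvd
    have h2 : (c i j).natAbs ≤ ∑ i, ∑ j, (c i j).natAbs :=
      (Finset.single_le_sum (f := fun j ↦ (c i j).natAbs) (fun _ _ ↦ Nat.zero_le _)
        (mem_univ j)).trans
        (Finset.single_le_sum (f := fun i ↦ ∑ j, (c i j).natAbs) (fun _ _ ↦ Nat.zero_le _)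
          (mem_univ i))
    have h3 := Nat.le_of_dvd (Int.natAbs_pos.mpr (hc0 i j hij)) h1
    omega
  have hset : (range p).filter (fun n : ℕ ↦ (p : ℤ) ∣ ∏ i, (f i).eval (n : ℤ)) =
      (univ : Finset ι).biUnion
        fun i ↦ (range p).filter fun n : ℕ ↦ (p : ℤ) ∣ (f i).eval (n : ℤ) := by
    ext n
    simp only [mem_filter, mem_biUnion, mem_univ, true_and]
    rw [(Nat.prime_iff_prime_int.mp hp).dvd_finsetProd_iff]
    simp
  simp only [polyRootCountMod_single]
  unfold polyRootCountMod
  rw [hset, card_biUnion]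
  intro i _ j _ hij
  rw [Function.onFun, Finset.disjoint_filter]
  intro n _ hi hj
  apply hpc i j hij
  have e := congrArg (eval (n : ℤ)) (hc i j hij)
  rw [eval_add, eval_mul, eval_mul, eval_C] at e
  rw [← e]
  exact dvd_add (dvd_mul_of_dvd_left hi _) (dvd_mul_of_dvd_left hj _)

/-- Step 1 for a Bateman–Horn system. Bateman–Horn 1962, p. 364. [folklore] -/
theorem IsBatemanHornSystem.exists_polyRootCountMod_eq_sum {f : ι → ℤ[X]}
    (hf : IsBatemanHornSystem f) :
    ∃ P₀ : ℕ, ∀ p : ℕ, p.Prime → P₀ < p →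
      polyRootCountMod f p = ∑ i, polyRootCountMod ![f i] p :=
  Literature.NumberTheory.Sieve.exists_polyRootCountMod_eq_sum hf.irreducible hf.pairwise_not_associated

/-- DISCHARGE of the named fact `AZFG2020_lemma_5_4_1` (Aletheia-Zomlefer–Fukshansky–Garcia
2020, Lemma 5.4.1 = Bateman–Horn 1962 p. 364): the exceptional primes lie below the `P₀` of
`exists_polyRootCountMod_eq_sum`. [cite: AletheiaZomleferFukshanskyGarcia2020, §5.4 Lemma 5.4.1 (5.4.2)] -/
theorem AZFG2020_lemma_5_4_1_holds : AZFG2020_lemma_5_4_1 := by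
  intro k f hirr hna
  obtain ⟨P₀, hP₀⟩ := exists_polyRootCountMod_eq_sum hirr hna
  refine (Set.finite_Iic P₀).subset fun p hp ↦ ?_
  obtain ⟨hp, hne⟩ := hp
  by_contra hle
  exact hne (hP₀ p hp (not_le.mp hle))

/-! ### From monic to positive leading coefficient (AZFG 2020 Lemma 5.3.5 ⇒ B–H's step 2)

Aletheia-Zomlefer–Fukshansky–Garcia vendor step 2 for MONIC irreducible `g`
(`AZFG2020_lemma_5_3_5`); Bateman–Horn need it for irreducible `f` with positive leading
coefficient `c`.  The passage is elementary: `g := integralNormalization f` is monic irreducible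
with `g(cx) = c^{d-1} f(x)`, so `ω_g(p) = ω_f(p)` for every prime `p ∤ c`, and the two series
differ by finitely many terms. -/

/-- `ω_g(p)` counted in `ZMod p`: the number of roots of `g mod p`. [folklore] -/
theorem polyRootCountMod_single_eq_card_zmod (g : ℤ[X]) (p : ℕ) [NeZero p] :
    polyRootCountMod ![g] p =
      #(univ.filter fun x : ZMod p ↦ (g.map (Int.castRingHom (ZMod p))).eval x = 0) := by
  classical
  rw [polyRootCountMod_single]
  refine Finset.card_nbij' (fun n : ℕ ↦ (n : ZMod p)) (fun x : ZMod p ↦ x.val) ?_ ?_ ?_ ?_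
  · intro n hn
    rw [mem_coe, mem_filter, mem_range] at hn
    simp only [mem_coe, mem_filter, mem_univ, true_and]
    rw [← Int.cast_natCast, eval_intCast_map, eq_intCast, ZMod.intCast_zmod_eq_zero_iff_dvd]
    exact hn.2
  · intro x hx
    simp only [mem_coe, mem_filter, mem_univ, true_and] at hx
    rw [mem_coe, mem_filter, mem_range]
    refine ⟨ZMod.val_lt x, ?_⟩
    have h : ((g.eval ((x.val : ℕ) : ℤ) : ℤ) : ZMod p) = 0 := by
      rw [← hx, ← eq_intCast (Int.castRingHom (ZMod p)), ← eval_natCast_map,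
        ZMod.natCast_zmod_val]
    exact (ZMod.intCast_zmod_eq_zero_iff_dvd _ _).mp h
  · intro n hn
    rw [mem_coe, mem_filter, mem_range] at hn
    exact ZMod.val_natCast_of_lt hn.1
  · intro x _
    exact ZMod.natCast_zmod_val x

/-- For a prime `p ∤ c = lc(f)`, `f` and its integral normalization `g` (`g(cx) = c^{d-1}f(x)`)
have the same number of roots mod `p` (`x ↦ cx` is a bijection of `ℤ/p`). [folklore] -/
theorem polyRootCountMod_integralNormalization {f : ℤ[X]} (hf : 1 ≤ f.natDegree) {p : ℕ}
    (hp : p.Prime) (hc : ¬(p : ℤ) ∣ f.leadingCoeff) :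
    polyRootCountMod ![integralNormalization f] p = polyRootCountMod ![f] p := by
  classical
  haveI := Fact.mk hp
  set φ := Int.castRingHom (ZMod p)
  have hc0 : φ f.leadingCoeff ≠ 0 := by
    rwa [eq_intCast, Ne, ZMod.intCast_zmod_eq_zero_iff_dvd]
  rw [polyRootCountMod_single_eq_card_zmod, polyRootCountMod_single_eq_card_zmod]
  symm
  refine Finset.card_nbij' (fun x ↦ φ f.leadingCoeff * x) (fun y ↦ (φ f.leadingCoeff)⁻¹ * y)
    ?_ ?_ ?_ ?_
  · intro x hx
    simp only [mem_coe, mem_filter, mem_univ, true_and] at hx ⊢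
    rw [eval_map, integralNormalization_eval₂_leadingCoeff_mul hf, ← eval_map, hx, mul_zero]
  · intro y hy
    simp only [mem_coe, mem_filter, mem_univ, true_and] at hy ⊢
    have h := integralNormalization_eval₂_leadingCoeff_mul hf φ ((φ f.leadingCoeff)⁻¹ * y)
    rw [mul_inv_cancel_left₀ hc0, ← eval_map, hy, ← eval_map] at h
    exact (mul_eq_zero.mp h.symm).resolve_left (pow_ne_zero _ hc0)
  · intro x _
    exact inv_mul_cancel_left₀ hc0 x
  · intro y _
    exact mul_inv_cancel_left₀ hc0 y

/-- The integral normalization `g` (`g(cx) = c^{d-1} f(x)`, monic) of an irreducible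
non-constant `f ∈ ℤ[X]` is irreducible: if `g = ab` with `a, b` monic then
`c^{d-1} f = a(cx) b(cx)`, and the prime `f` divides a factor, forcing `deg a = d` or `deg b = d`.
[folklore] -/
theorem irreducible_integralNormalization {f : ℤ[X]} (hf : Irreducible f)
    (hd : 1 ≤ f.natDegree) : Irreducible (integralNormalization f) := by
  have hf0 : f ≠ 0 := hf.ne_zero
  have hmon : (integralNormalization f).Monic := monic_integralNormalization hf0
  have hc0 : f.leadingCoeff ≠ 0 := leadingCoeff_ne_zero.mpr hf0
  have key : (integralNormalization f).comp (C f.leadingCoeff * X) =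
      C (f.leadingCoeff ^ (f.natDegree - 1)) * f := by
    show eval₂ C (C f.leadingCoeff * X) (integralNormalization f) = _
    rw [integralNormalization_eval₂_leadingCoeff_mul hd, eval₂_C_X, ← C_pow]
  have hq : (C f.leadingCoeff * X : ℤ[X]).natDegree = 1 := natDegree_C_mul_X _ hc0
  have hrhs : C (f.leadingCoeff ^ (f.natDegree - 1)) * f ≠ 0 :=
    mul_ne_zero (C_ne_zero.mpr (pow_ne_zero _ hc0)) hf0
  refine hmon.irreducible_iff_natDegree.mpr ⟨fun h1 ↦ ?_, fun a b ha hb hab ↦ ?_⟩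
  · have := congrArg natDegree h1
    rw [natDegree_integralNormalization, natDegree_one] at this
    omega
  · have hcomp : a.comp (C f.leadingCoeff * X) * b.comp (C f.leadingCoeff * X) =
        C (f.leadingCoeff ^ (f.natDegree - 1)) * f := by
      rw [← mul_comp, hab, key]
    have hdvd : f ∣ a.comp (C f.leadingCoeff * X) * b.comp (C f.leadingCoeff * X) :=
      ⟨C (f.leadingCoeff ^ (f.natDegree - 1)), by rw [hcomp, mul_comm]⟩
    have hdeg : a.natDegree + b.natDegree = f.natDegree := by
      have := congrArg natDegree hab
      rwa [ha.natDegree_mul hb, natDegree_integralNormalization] at this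
    have hne : a.comp (C f.leadingCoeff * X) ≠ 0 ∧ b.comp (C f.leadingCoeff * X) ≠ 0 := by
      rw [← not_or, ← mul_eq_zero, hcomp]
      exact hrhs
    rcases hf.prime.dvd_or_dvd hdvd with h | h
    · have := natDegree_le_of_dvd h hne.1
      rw [natDegree_comp, hq, mul_one] at this
      right
      omega
    · have := natDegree_le_of_dvd h hne.2
      rw [natDegree_comp, hq, mul_one] at this
      left
      omega

/-- **Step 2 for positive leading coefficient from the monic case:** the named fact
`AZFG2020_lemma_5_3_5` (Aletheia-Zomlefer–Fukshansky–Garcia 2020, Lemma 5.3.5: for monic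
irreducible `g`, `∑_p (ω_g(p) − 1)/p` converges) implies Bateman–Horn's step 2
`BatemanHorn1962_rootCountSeries`, via `g = integralNormalization f` and
`ω_g(p) = ω_f(p)` for `p ∤ lc(f)`.
[cite: AletheiaZomleferFukshanskyGarcia2020, §5.3 Lemma 5.3.5] -/
theorem BatemanHorn1962_rootCountSeries_of_AZFG2020_lemma_5_3_5 (h : AZFG2020_lemma_5_3_5) :
    BatemanHorn1962_rootCountSeries := by
  intro f hf hd hlc
  obtain ⟨L, hL⟩ := h (integralNormalization f) (monic_integralNormalization hf.ne_zero)
    (irreducible_integralNormalization hf hd)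
  set g := integralNormalization f with hg
  set N := f.leadingCoeff.natAbs with hN
  set E : ℝ := ∑ p ∈ Nat.primesLE N,
    ((polyRootCountMod ![f] p : ℝ) - polyRootCountMod ![g] p) / p with hE
  refine ⟨L + E, (hL.add_const E).congr' ?_⟩
  rw [EventuallyEq, eventually_atTop]
  refine ⟨N, fun x hx ↦ ?_⟩
  have hsub : Nat.primesLE N ⊆ Nat.primesLE x := fun p hp ↦ by
    rw [Nat.mem_primesLE] at hp ⊢
    exact ⟨hp.1.trans hx, hp.2⟩
  rw [hE, Finset.sum_subset hsub, ← Finset.sum_add_distrib]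
  · exact Finset.sum_congr rfl fun p _ ↦ by ring
  · intro p hpx hpN
    rw [Nat.mem_primesLE] at hpx
    have hlt : N < p := by
      by_contra h'
      exact hpN (Nat.mem_primesLE.mpr ⟨not_lt.mp h', hpx.2⟩)
    rw [hg, polyRootCountMod_integralNormalization hd hpx.2, sub_self, zero_div]
    intro hdvd
    have := Nat.le_of_dvd (Int.natAbs_pos.mpr hlc.ne') (Int.natCast_dvd.mp hdvd)
    omega

/-! ### Step 3: the logarithmic estimate and the limit (B–H p. 365) -/

/-- `|log(1 − u) + u| ≤ 2u²` for `0 ≤ u ≤ 1/2` (Taylor). [folklore] -/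
theorem abs_log_one_sub_add_le {u : ℝ} (hu0 : 0 ≤ u) (hu : u ≤ 1 / 2) :
    |Real.log (1 - u) + u| ≤ 2 * u ^ 2 := by
  have h := Real.abs_log_sub_add_sum_range_le (x := u) (by rw [abs_of_nonneg hu0]; linarith) 1
  rw [Finset.sum_range_one, abs_of_nonneg hu0] at h
  norm_num at h
  rw [add_comm]
  calc |u + Real.log (1 - u)| ≤ u ^ 2 / (1 - u) := h
    _ ≤ 2 * u ^ 2 := by
      rw [div_le_iff₀ (by linarith)]
      nlinarith [mul_nonneg (sq_nonneg u) (by linarith : (0 : ℝ) ≤ 1 - 2 * u)]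

/-- **Bateman–Horn 1962, pp. 364–365, elementary part.**  Granting the convergence of
`∑_p (ω_{fᵢ}(p) − 1)/p` for each member of the system (`BatemanHorn1962_rootCountSeries`, the
prime-ideal-theorem input), the Bateman–Horn product `∏_p (1 - 1/p)^{-k}(1 - ω(p)/p)` of a
Bateman–Horn system converges (in increasing order of `p`) to a positive limit.
[cite: BatemanHornMathComp1962, pp. 364–365 (convergence of the product defining C(f₁,…,f_k))] -/
theorem exists_hasBatemanHornConst_of_rootCountSeries (H : BatemanHorn1962_rootCountSeries) :
    exists_hasBatemanHornConst (ι := ι) := by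
  intro f hf
  classical
  -- Step 2 (vendored): one limit `A i` per member.
  choose A hA using
    fun i ↦ H (f i) (hf.irreducible i) (hf.natDegree_pos i) (hf.leadingCoeff_pos i)
  -- Step 1: `ω = ∑ ωᵢ` beyond `P₀`.
  obtain ⟨P₀, hP₀⟩ := hf.exists_polyRootCountMod_eq_sum
  set k : ℕ := Fintype.card ι with hk
  set D : ℕ := ∑ i, (f i).natDegree with hD
  set P₁ : ℕ := ∑ i, ((f i).leadingCoeff).natAbs with hP₁
  set ω : ℕ → ℕ := polyRootCountMod f with hω
  -- `ωᵢ(p) ≤ deg fᵢ` beyond `P₁`, hence `ω(p) ≤ D` beyond `P₀ + P₁`.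
  have hdeg : ∀ p, p.Prime → P₁ < p → ∀ i, polyRootCountMod ![f i] p ≤ (f i).natDegree := by
    intro p hp hlt i
    refine polyRootCountMod_single_le_natDegree hp fun hdvd ↦ ?_
    have h1 : p ∣ ((f i).leadingCoeff).natAbs := Int.natCast_dvd.mp hdvd
    have h2 : ((f i).leadingCoeff).natAbs ≤ P₁ :=
      Finset.single_le_sum (f := fun i ↦ ((f i).leadingCoeff).natAbs) (fun _ _ ↦ Nat.zero_le _)
        (mem_univ i)
    have h3 := Nat.le_of_dvd (Int.natAbs_pos.mpr (hf.leadingCoeff_pos i).ne') h1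
    omega
  have hωD : ∀ p, p.Prime → P₀ + P₁ < p → (ω p : ℝ) ≤ D := by
    intro p hp hlt
    rw [hP₀ p hp (by omega), hD]
    push_cast
    exact Finset.sum_le_sum fun i _ ↦ by exact_mod_cast hdeg p hp (by omega) i
  -- The factors `a p` of the product are positive.
  have hone : ∀ p : ℕ, p.Prime → 0 < 1 - 1 / (p : ℝ) := by
    intro p hp
    have hp2 : (2 : ℝ) ≤ p := by exact_mod_cast hp.two_le
    rw [sub_pos, div_lt_one (by linarith)]
    linarith
  have hone' : ∀ p : ℕ, p.Prime → 0 < 1 - (ω p : ℝ) / p := by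
    intro p hp
    have hp2 : (2 : ℝ) ≤ p := by exact_mod_cast hp.two_le
    rw [sub_pos, div_lt_one (by linarith)]
    exact_mod_cast hf.hasNoFixedPrimeDivisor p hp
  set a : ℕ → ℝ := fun p ↦ (1 - 1 / (p : ℝ))⁻¹ ^ k * (1 - (ω p : ℝ) / p) with ha
  have ha_pos : ∀ p, p.Prime → 0 < a p := fun p hp ↦
    mul_pos (pow_pos (inv_pos.mpr (hone p hp)) _) (hone' p hp)
  -- `t p = log a_p + ∑ᵢ (ωᵢ(p) − 1)/p = O(1/p²)`.
  set t : ℕ → ℝ := fun p ↦ Real.log (a p) + ∑ i, ((polyRootCountMod ![f i] p : ℝ) - 1) / p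
    with ht
  set M : ℝ := 2 * k + 2 * (D : ℝ) ^ 2 with hM
  have ht_bound : ∀ p, p.Prime → P₀ + P₁ + 2 * D < p → |t p| ≤ M / (p : ℝ) ^ 2 := by
    intro p hp hlt
    have hp2 : (2 : ℝ) ≤ p := by exact_mod_cast hp.two_le
    have hp0 : (0 : ℝ) < p := by linarith
    set u : ℝ := 1 / p with hu
    set w : ℝ := (ω p : ℝ) / p with hw
    have hu0 : 0 ≤ u := by positivity
    have hu2 : u ≤ 1 / 2 := by rw [hu]; gcongr
    have hw0 : 0 ≤ w := by positivity
    have hωp : (ω p : ℝ) ≤ D := hωD p hp (by omega)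
    have h2D : (2 * D : ℝ) < p := by exact_mod_cast (show 2 * D < p by omega)
    have hw2 : w ≤ 1 / 2 := by
      rw [hw, div_le_iff₀ hp0]
      linarith
    have hwD : w ≤ D / p := by rw [hw]; gcongr
    have hsum : ∑ i, ((polyRootCountMod ![f i] p : ℝ) - 1) / p = w - k * u := by
      rw [← Finset.sum_div, Finset.sum_sub_distrib, Finset.sum_const, card_univ, ← hk,
        nsmul_eq_mul, mul_one, hw, hP₀ p hp (by omega)]
      push_cast
      ring
    have hlog : Real.log (a p) = -(k * Real.log (1 - u)) + Real.log (1 - w) := by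
      rw [ha]
      dsimp only
      rw [Real.log_mul (pow_pos (inv_pos.mpr (hone p hp)) _).ne' (hone' p hp).ne',
        Real.log_pow, Real.log_inv]
      ring
    have e : t p = -(k : ℝ) * (Real.log (1 - u) + u) + (Real.log (1 - w) + w) := by
      rw [ht]
      dsimp only
      rw [hsum, hlog]
      ring
    rw [e]
    have b1 := abs_log_one_sub_add_le hu0 hu2
    have b2 := abs_log_one_sub_add_le hw0 hw2
    calc |-(k : ℝ) * (Real.log (1 - u) + u) + (Real.log (1 - w) + w)|
        ≤ |-(k : ℝ) * (Real.log (1 - u) + u)| + |Real.log (1 - w) + w| := abs_add_le _ _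
      _ = k * |Real.log (1 - u) + u| + |Real.log (1 - w) + w| := by
          rw [abs_mul, abs_neg, Nat.abs_cast]
      _ ≤ k * (2 * u ^ 2) + 2 * w ^ 2 := by gcongr
      _ ≤ k * (2 * u ^ 2) + 2 * ((D : ℝ) / p) ^ 2 := by gcongr
      _ = M / (p : ℝ) ^ 2 := by
          rw [hM, hu]
          field_simp
  -- Hence `t` (extended by `0` off the primes) is summable and its prime partial sums converge.
  set g : ℕ → ℝ := fun n ↦ if n.Prime then t n else 0 with hg
  have hM0 : 0 ≤ M := by rw [hM]; positivity
  have hg_sum : Summable g := by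
    refine Summable.of_norm_bounded_eventually_nat (g := fun n ↦ M / (n : ℝ) ^ 2) ?_ ?_
    · simpa [div_eq_mul_one_div M] using (Real.summable_one_div_nat_pow.mpr one_lt_two).mul_left M
    · rw [eventually_atTop]
      refine ⟨P₀ + P₁ + 2 * D + 1, fun n hn ↦ ?_⟩
      rw [hg]
      dsimp only
      split_ifs with hn'
      · rw [Real.norm_eq_abs]
        exact ht_bound n hn' (by omega)
      · rw [norm_zero]
        positivity
  have hT : Tendsto (fun x : ℕ ↦ ∑ p ∈ Nat.primesLE x, t p) atTop (𝓝 (∑' n, g n)) := by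
    have h1 : (fun x : ℕ ↦ ∑ p ∈ Nat.primesLE x, t p) =
        (fun m ↦ ∑ n ∈ range m, g n) ∘ fun x ↦ x + 1 := by
      funext x
      simp only [Function.comp_apply, Nat.primesLE_eq_filter_range, Finset.sum_filter, hg]
    rw [h1]
    exact hg_sum.hasSum.tendsto_sum_nat.comp (tendsto_add_atTop_nat 1)
  -- The partial product is `exp` of `∑_{p ≤ x} t p − ∑ᵢ ∑_{p ≤ x} (ωᵢ(p) − 1)/p`.
  have hexp : ∀ x, batemanHornPartial f x = Real.exp (∑ p ∈ Nat.primesLE x, t p -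
      ∑ i, ∑ p ∈ Nat.primesLE x, ((polyRootCountMod ![f i] p : ℝ) - 1) / p) := by
    intro x
    have hcomm : ∑ i, ∑ p ∈ Nat.primesLE x, ((polyRootCountMod ![f i] p : ℝ) - 1) / p =
        ∑ p ∈ Nat.primesLE x, ∑ i, ((polyRootCountMod ![f i] p : ℝ) - 1) / p :=
      Finset.sum_comm
    rw [hcomm, ← Finset.sum_sub_distrib]
    simp only [ht, add_sub_cancel_right]
    rw [Real.exp_sum]
    unfold batemanHornPartial
    refine Finset.prod_congr rfl fun p hp ↦ ?_
    rw [Real.exp_log (ha_pos p (Nat.mem_primesLE.mp hp).2)]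
  refine ⟨Real.exp (∑' n, g n - ∑ i, A i), Real.exp_pos _, ?_⟩
  unfold HasBatemanHornConst
  rw [show batemanHornPartial f = _ from funext hexp]
  exact (Real.continuous_exp.tendsto _).comp (hT.sub (tendsto_finsetSum _ fun i _ ↦ hA i))

/-- The chain to the tree's already-vendored leaf: Aletheia-Zomlefer–Fukshansky–Garcia 2020,
Lemma 5.3.5 (Mertens' theorems for `ℚ` and for `ℚ(θ)` plus Dedekind–Kummer) implies the
convergence of the Bateman–Horn product to a positive limit.
[cite: AletheiaZomleferFukshanskyGarcia2020, §5.4 Theorem 5.4.3 (proof)] -/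
theorem exists_hasBatemanHornConst_of_AZFG2020_lemma_5_3_5 (h : AZFG2020_lemma_5_3_5) :
    exists_hasBatemanHornConst (ι := ι) :=
  exists_hasBatemanHornConst_of_rootCountSeries
    (BatemanHorn1962_rootCountSeries_of_AZFG2020_lemma_5_3_5 h)

/-- Display (5.4.4) of Aletheia-Zomlefer–Fukshansky–Garcia 2020 (`∑_p (k − ω(p))/p` converges for
a Bateman–Horn system) from Bateman–Horn's step 2 and step 1: beyond `P₀`,
`(k − ω(p))/p = −∑ᵢ (ωᵢ(p) − 1)/p`. [cite: AletheiaZomleferFukshanskyGarcia2020, §5.4 (5.4.4)] -/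
theorem AZFG2020_tendsto_sum_sub_omega_div_of_rootCountSeries
    (H : BatemanHorn1962_rootCountSeries) : AZFG2020_tendsto_sum_sub_omega_div := by
  intro k f hf
  choose A hA using
    fun i ↦ H (f i) (hf.irreducible i) (hf.natDegree_pos i) (hf.leadingCoeff_pos i)
  obtain ⟨P₀, hP₀⟩ := hf.exists_polyRootCountMod_eq_sum
  set E : ℝ := ∑ p ∈ Nat.primesLE P₀, (((k : ℝ) - polyRootCountMod f p) / p +
    ∑ i, ((polyRootCountMod ![f i] p : ℝ) - 1) / p) with hE
  refine ⟨-∑ i, A i + E, (((tendsto_finsetSum _ fun i _ ↦ hA i).neg).add_const E).congr' ?_⟩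
  rw [EventuallyEq, eventually_atTop]
  refine ⟨P₀, fun x hx ↦ ?_⟩
  have hsub : Nat.primesLE P₀ ⊆ Nat.primesLE x := fun p hp ↦ by
    rw [Nat.mem_primesLE] at hp ⊢
    exact ⟨hp.1.trans hx, hp.2⟩
  rw [Finset.sum_comm, hE, Finset.sum_subset hsub, ← Finset.sum_neg_distrib,
    ← Finset.sum_add_distrib]
  · exact Finset.sum_congr rfl fun p _ ↦ by ring
  · intro p hpx hpP
    rw [Nat.mem_primesLE] at hpx
    have hlt : P₀ < p := by
      by_contra h'
      exact hpP (Nat.mem_primesLE.mpr ⟨not_lt.mp h', hpx.2⟩)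
    rw [hP₀ p hpx.2 hlt, ← Finset.sum_div, ← add_div, Finset.sum_sub_distrib, Finset.sum_const,
      card_univ, Fintype.card_fin]
    push_cast
    ring

/-- (5.4.4) from the tree's leaf `AZFG2020_lemma_5_3_5`.
[cite: AletheiaZomleferFukshanskyGarcia2020, §5.4 (5.4.4)] -/
theorem AZFG2020_tendsto_sum_sub_omega_div_of_lemma_5_3_5 (h : AZFG2020_lemma_5_3_5) :
    AZFG2020_tendsto_sum_sub_omega_div :=
  AZFG2020_tendsto_sum_sub_omega_div_of_rootCountSeries
    (BatemanHorn1962_rootCountSeries_of_AZFG2020_lemma_5_3_5 h)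

/-! ### Appendix: the analytic leaf proved — `exists_hasBatemanHornConst_holds`

Bateman–Horn's step 2 ("by an elementary result on the distribution of prime ideals … the series
`∑_p (ω_i(p) − 1)/p` converges", p. 364) is `AZFG2020_lemma_5_3_5`, proved in
`Literature/NumberTheory/LFunctions/DegreeOnePrimes.lean` without the prime ideal theorem:
Dedekind–Kummer identifies `ω_g(p)` with the number `r_K(p)` of degree-one primes of
`K = ℚ[x]/(g)` above `p` for all `p ∤ [𝓞_K : ℤ[θ]]`-exponent; `Σ_p (r_K(p) − 1) p^{-s}` has a limit
as `s → 1⁺` by `log ζ_K − log ζ` and the class number formula residue (Mathlib's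
`NumberField.tendsto_sub_one_mul_dedekindZeta_nhdsGT`); and the Hardy–Littlewood (Karamata)
Tauberian theorem for prime sums with bounded coefficients turns this into convergence of the
ordered sums. Combined with steps 1 and 3 above this discharges `exists_hasBatemanHornConst`. -/

/-- **Lemma 5.3.5 of Aletheia-Zomlefer–Fukshansky–Garcia 2020 = Bateman–Horn 1962, p. 364,
step 2 — PROVED.** For `g ∈ ℤ[X]` monic irreducible, `∑_{p ≤ x} (ω_g(p) − 1)/p` converges
(`Literature.NumberTheory.LFunctions.DegreeOnePrimes.exists_tendsto_sum_primesLE_rootCount_sub_one_div` restated with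
`polyRootCountMod`). [cite: AletheiaZomleferFukshanskyGarcia2020, §5.3 Lemma 5.3.5] -/
theorem AZFG2020_lemma_5_3_5_holds : AZFG2020_lemma_5_3_5 := by
  intro g hg hirr
  simp only [polyRootCountMod_single]
  exact LFunctions.DegreeOnePrimes.exists_tendsto_sum_primesLE_rootCount_sub_one_div hg hirr

/-- Bateman–Horn 1962, p. 364, step 2, for an arbitrary irreducible `f ∈ ℤ[X]` of positive degree
and leading coefficient: `∑_{p ≤ x} (ω_f(p) − 1)/p` converges — PROVED (integral normalization
and `AZFG2020_lemma_5_3_5_holds`). [cite: BatemanHornMathComp1962, p. 364] -/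
theorem BatemanHorn1962_rootCountSeries_holds : BatemanHorn1962_rootCountSeries :=
  BatemanHorn1962_rootCountSeries_of_AZFG2020_lemma_5_3_5 AZFG2020_lemma_5_3_5_holds

/-- **Bateman–Horn 1962, pp. 364–365: for a Bateman–Horn system the product defining
`C(f₁, …, f_k)` converges to a positive limit — PROVED.** Discharges the named fact
`Literature.NumberTheory.Sieve.exists_hasBatemanHornConst` of `Sieve/BatemanHorn.lean`.
[cite: BatemanHornMathComp1962, pp. 364–365] -/
theorem exists_hasBatemanHornConst_holds : exists_hasBatemanHornConst (ι := ι) :=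
  exists_hasBatemanHornConst_of_AZFG2020_lemma_5_3_5 AZFG2020_lemma_5_3_5_holds

/-- Display (5.4.4) of Aletheia-Zomlefer–Fukshansky–Garcia 2020 (`∑_p (k − ω(p))/p` converges for
a Bateman–Horn system) — PROVED. [cite: AletheiaZomleferFukshanskyGarcia2020, §5.4 (5.4.4)] -/
theorem AZFG2020_tendsto_sum_sub_omega_div_holds : AZFG2020_tendsto_sum_sub_omega_div :=
  AZFG2020_tendsto_sum_sub_omega_div_of_lemma_5_3_5 AZFG2020_lemma_5_3_5_holds

/-- **Bateman–Horn 1962, §2 / pp. 364–365: for a Bateman–Horn system the partial products converge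
to `batemanHornConst f`, which is positive — PROVED.** Discharges the named fact
`Literature.NumberTheory.Sieve.IsBatemanHornSystem.hasBatemanHornConst` of `Sieve/BatemanHorn.lean` (its demoted interim
proof, restored on top of `exists_hasBatemanHornConst_holds`).
[cite: BatemanHornMathComp1962, pp. 364–365] -/
theorem IsBatemanHornSystem.hasBatemanHornConst_holds :
    IsBatemanHornSystem.hasBatemanHornConst (ι := ι) := by
  intro f hf
  obtain ⟨C, hC, h⟩ := exists_hasBatemanHornConst_holds hf
  rw [h.batemanHornConst_eq]
  exact ⟨h, hC⟩

end Literature.NumberTheory.Sieve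

end
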